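import Summits.Ventures.Crystal3D.LocalLP.H1Instance
import Summits.Ventures.Crystal3D.Statement
import HarnessLib

/-!
# Instance H1′: `C(x) < 6N - 2.81 · N^{2/3}` CONDITIONAL on the named inputs at probing radius `1`
# with the Kepler surface constant

HONEST FRAMING. Part of the venture `Summits/Ventures/Crystal3D` (cell `pub-crystal3d`, LP lane
headline "H1′", engine-2 `LEMMAS.md` §6 / CLAIMS row B.H1′). This file PROVES an implication only:

  `LevyCapInput 1 F_H1 → IsoInput 1 sKepler → ∀ N ≥ 2, ∀ packing x of N diameter-1 balls in
   ℝ³, C(x) < 6N - (281/100) N^{2/3}`,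

where `sKepler = 15.353 / 16π` is a rational underestimate of the Kepler surface constant
`(1152π)^{1/3} / 16π = (π/√18)^{-2/3} / 4 ≈ 0.30546` (fraction of the radius-`2` probing sphere,
radius-`1` units): under the Kepler bound in Bezdek's doubled-balls form the union of the
radius-`2` balls has volume `≥ 4√2 · N`, and Federer's isoperimetric inequality turns this into
exposed area `≥ (1152π)^{1/3} N^{2/3}`. That derivation of `(I)` from the two Literature named
facts is NOT in this file (it is `isoInput_one_of_kepler`, file `LocalLP/IsoDensity.lean`); here
`(I)` is a hypothesis, `(L)` is the cell's certified cap table `FH1` (CELL5 + Lévy; hypothesis) and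
`(K)` is discharged (`saturationInput_one`). Kernel-checked here: `15.353³ ≤ 1152π`
(`Real.pi_gt_d6`), the table domination by `ρ = A_6/6` (from `H1Instance`), the margin
`2.81 · A_6 < 3 · 15.353`, base cases `N = 2…7`, the step threshold `(281/150)³ ≤ 7`, and the
induction with `k₀ = 5`. No crystallization statement is claimed.
-/

noncomputable section

open scoped BigOperators
open Real

namespace Summit.Ventures.Crystal3D

/-- The Kepler surface constant of H1′ as a sphere fraction: `15.353 / 16π`, where
`15.353 ≤ (1152π)^{1/3} = 4π (π/√18)^{-2/3}` (`sKepler_certificate`). -/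
def sKepler : ℝ := 15353 / 1000 / cH1

/-- `sKepler > 0`. -/
theorem sKepler_pos : 0 < sKepler := div_pos (by norm_num) cH1_pos

/-- The certificate behind `sKepler`: `15.353³ ≤ 1152 π` (needs only `π > 3.141592`). -/
theorem sKepler_certificate : (15353 / 1000 : ℝ) ^ 3 ≤ 1152 * π := by
  have hπ := Real.pi_gt_d6
  nlinarith

/-- **The H1′ headline, conditional on `(L)` and `(I)` with the Kepler constant.** If the cap
input holds at probing radius `1` with engine-2's certified table `FH1` and the isoperimetric input
holds with the constant `sKepler`, then every packing of `N ≥ 2` diameter-`1` balls in `ℝ³` has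
fewer than `6N - (281/100) N^{2/3}` contacts. -/
theorem H1K_surfaceBound (hL : LevyCapInput 1 FH1) (hI : IsoInput 1 sKepler) :
    ∀ N : ℕ, 2 ≤ N → ∀ x : Fin N → EuclideanSpace ℝ (Fin 3), IsUnitPacking x →
      (numContacts x : ℝ) < 6 * N - (281 / 100 : ℝ) * (N : ℝ) ^ ((2 : ℝ) / 3) := by
  have hc := cH1_pos
  refine surfaceBound_of_inputs (ρ := 16390850526116 / 1000000000000 / 6 / cH1) (k₀ := 5)
    (N₁ := 7) hL saturationInput_one hI (div_pos (by norm_num) hc) ?table ?gamma (by norm_num)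
    ?base ?step
  case table =>
    intro k hk hk11
    have hF : FH1 k = areaH1 k / cH1 := by simp [FH1, show ¬ k ≤ 5 by omega]
    rw [hF, div_mul_eq_mul_div]
    exact div_le_div_of_nonneg_right (areaH1_le k hk hk11) hc.le
  case gamma =>
    -- 281/100 < sKepler / (2 · (A_6/6)/16π) = 3 · 15.353 / A_6
    have h : sKepler / (2 * (16390850526116 / 1000000000000 / 6 / cH1)) =
        3 * (15353 / 1000) / (16390850526116 / 1000000000000) := by
      unfold sKepler; field_simp; ring
    rw [h, lt_div_iff₀ (by norm_num)]
    norm_num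
  case base =>
    intro N hN2 hN7 x _
    have hγ : (0 : ℝ) ≤ 281 / 100 := by norm_num
    interval_cases N
    · exact base_case_of_choose_two (q := 8 / 5) hγ
        (rpow_two_thirds_le_of_sq_le_cube (by norm_num) (by norm_num) (by norm_num))
        (by norm_num) x
    · exact base_case_of_choose_two (q := 209 / 100) hγ
        (rpow_two_thirds_le_of_sq_le_cube (by norm_num) (by norm_num) (by norm_num))
        (by norm_num) x
    · exact base_case_of_choose_two (q := 63 / 25) hγ
        (rpow_two_thirds_le_of_sq_le_cube (by norm_num) (by norm_num) (by norm_num))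
        (by norm_num) x
    · exact base_case_of_choose_two (q := 3) hγ
        (rpow_two_thirds_le_of_sq_le_cube (by norm_num) (by norm_num) (by norm_num))
        (by norm_num) x
    · exact base_case_of_choose_two (q := 10 / 3) hγ
        (rpow_two_thirds_le_of_sq_le_cube (by norm_num) (by norm_num) (by norm_num))
        (by norm_num) x
    · exact base_case_of_choose_two (q := 11 / 3) hγ
        (rpow_two_thirds_le_of_sq_le_cube (by norm_num) (by norm_num) (by norm_num))
        (by norm_num) x
  case step =>
    refine step_of_threshold (by norm_num) (by norm_num) ?_
    -- 2 · 281/100 ≤ 3 · (6 - 5) · 7^{1/3}, since (281/150)³ ≤ 7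
    have h7 : (281 / 150 : ℝ) ≤ (7 : ℝ) ^ ((1 : ℝ) / 3) := by
      have h : ((281 / 150 : ℝ) ^ 3) ^ ((1 : ℝ) / 3) ≤ (7 : ℝ) ^ ((1 : ℝ) / 3) :=
        Real.rpow_le_rpow (by norm_num) (by norm_num) (by norm_num)
      have h' : ((281 / 150 : ℝ) ^ 3) ^ ((1 : ℝ) / 3) = 281 / 150 := by
        rw [← Real.rpow_natCast, ← Real.rpow_mul (by norm_num)]; norm_num
      rwa [h'] at h
    push_cast
    linarith

/-- H1′ as a `SurfaceBound` rung: `(L)` with the table `FH1` and `(I)` with the Kepler constant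
give `SurfaceBound (281/100)`. -/
theorem surfaceBound_H1K_rung (hL : LevyCapInput 1 FH1) (hI : IsoInput 1 sKepler) :
    SurfaceBound (281 / 100) :=
  fun N hN x hx => H1K_surfaceBound hL hI N hN x hx

end Summit.Ventures.Crystal3D

end
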